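import Summits.ResolutionOfSingularities.ResolutionOfSingularities.Theorems.MarkedTransferCampaignG1PnegaObligationF33StdCaseIII2
import Summits.ResolutionOfSingularities.ResolutionOfSingularities.Theorems.MarkedTransferCampaignG1PnegaObligationF33StdSandwich
import Literature.AlgebraicGeometry.Hironaka2017.Proofs.S09LLUED.Rem911CaseIIIb
import Literature.AlgebraicGeometry.Hironaka2017.Proofs.S09LLUED.Eq76
import HarnessLib

/-!
# [OURS · L1 G1 ℘nega-INTERFACE] Obligation F3.3 RETYPED — the unit question DECIDED: Case (III) is unit-free for EVERY `k̄`,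
# units come ONLY from the Case-(I) recipe in the (I)∧(II) overlap, and the «II-first» column DISCRIMINATES (✓ `jacWitness`)
# (R40/#case-overlap material for res-adj-2; closes the item left open in `…F33StdCaseIII2` «k̄ ≥ 3»). By res-type-063 (gen 7); carried by res-L1-type-o6.

CARRIER NOTE (res-L1-type-o6 g17): KERNEL by res-type-063 (HOME draft `D/res-type-063/PnegaObligationF33StdIIFirst.draft.lean` sha16
8e73397ab974dcca, DRAFT READY + CARRY ask 2026-08-27T06:30:56Z, TAKING 06:32:13Z), summit-side VERBATIM (this note added). [OURS · L1 G1]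
replaces the role of: nothing printed beyond what the decl docstrings cite — data-level kernels deciding the unit question of the
retyped obligation F3.3 (R40/#case-overlap reading material for res-adj-2); NOT a statement of the manuscript.
HONEST FRAMING. Nothing here is a statement of H. Hironaka's manuscript *Resolution of singularities in positive characteristics*
(2017-03-23, [Hironaka2017], lit key `paper:url-3343fd9e678b`; every printed item is a CANDIDATE [claim: Hironaka2017, status:
under-review]). The theorems are about the typed `H♭`-datum (`HFlatDatum`, p496649), the typed recipes of row 057 (`HFlat.caseI/II/III`,
`HFlat.op`) and row 057b's selection `HFlat.selectIIFirst` (a READING asked for by res-adj-2, not a printed tie-break). AI kernel work,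
weaker than expert review; nothing here is progress on resolution of singularities in positive characteristic; no claim beyond the kernel.

## What is proved (completion placement `K'[[x]] = MvPowerSeries (Fin n) K'`, `K'` a field of characteristic `p`, `p` prime; NO order
## clause anywhere — only §8.3 (1) `ord ϵ(0) > q` and the typed standard expression (76), both fields of `HFlatDatum`)
* §1 `HFlatDatum.adicOrder_le_caseIII_value` / `q_lt_adicOrder_caseIII_value` / `caseIII_value_mem_maximalIdeal` — in Case (III) of Lem. 9.6,
  for EVERY `k̄`, `ord H♭(ϵ(0)) = ord (h♭)^{k̄}(ϵ(0)) ≥ ord ϵ(0) > q`; in particular `H♭(ϵ(0)) ∈ 𝔪^{q+1} ⊆ 𝔪`. This is res-type-056's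
  support-class theorem `HFlat.CaseIII.adicOrder_le_caseIII` (Proofs/S09LLUED/Rem911CaseIIIb — GAP R05 key S-III-iterate) applied to the
  datum: its premises `0 < e ≤ ℓ`, Eq. (76)(1) (`Eq76_1_holds`, Proofs/S09LLUED/Eq76), Case (III), `q < ord ϵ(0)` are all FIELDS of
  `HFlatDatum` (resp. theorems). The `k̄ = 2` lattice argument of `…F33StdCaseIII2` is thereby superseded (it stays correct).
* §2 `HFlatDatum.value_mem_maximalIdeal_of_not_overlap` — **the complete answer to R40/#case-overlap at data level**: the value `H♭(ϵ(0))`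
  of a datum lies in `𝔪` UNLESS its case witness is (I) while (II) «|α+pβ| > q» also holds; equivalently
  `HFlatDatum.caseI_and_isCaseII_of_isUnit_value` — a unit value can only be the Case-(I) recipe evaluated in the (I)∧(II) overlap
  (where `…F33StdCaseI` exhibits one: `CaseIDatum.isUnit_value`). Hence `HFlatDatum.value_mem_maximalIdeal_of_selectIIFirst` — under
  «II-first» EVERY datum is unit-free (supersedes `…_of_selectIIFirst_of_not_caseIII` of `…F33StdSandwich` §4 and `…_of_caseIII_kBar_two`);
  `HFlatDatum.value_mem_maximalIdeal_of_not_isCaseII` — outside (II) every witness (e.g. the «I-first» one) is unit-free.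
* §3 `PnegaInterfaceV4.jacWitness_F33std_RIIfirst`, `exists_nonVanishing_and_F33std_RIIfirst` — the Jacobson witness of `…F33StdOrdWitness`
  (negative pieces `jac(P 1)`, F6c ✓ F7c ✓, empty provenance) MEETS `F33std_RIIfirst`; with `…F33StdReadings` (✗ ⊥-bypass, ✗ every
  F6d-elt(e ≥ 1) inhabitant, ✗ every F3⁻ inhabitant) the «II-first» column DISCRIMINATES exactly like the ORDER column `F33stdOrd`.
  Also `PnegaInterfaceV4.jacWitness_value_mem_of_not_overlap` — the same witness meets the UNRESTRICTED `F33std` demand at every datum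
  outside the overlap (the reading as a hypothesis on the datum, no new obligation defined).
No `def`s (kernel file). Imports: …F33StdCaseIII2, …F33StdSandwich (tree), Proofs.S09LLUED.Rem911CaseIIIb (res-type-056), Proofs.S09LLUED.Eq76.
-/

noncomputable section

set_option linter.dupNamespace false -- mandated namespace of this single-conjunct summit

namespace Summit.ResolutionOfSingularities.ResolutionOfSingularities.Theorems.Campaign.PnegaObligation

open Literature.AlgebraicGeometry.Hironaka2017 Literature.AlgebraicGeometry.Hironaka2017.S09LLUED
open Literature.RingTheory.MvPowerSeries (hasseDeriv adicOrder_eq_order)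
open Literature.RingTheory.MvPowerSeries.Jets (mem_maximalIdeal_iff_one_le_order mem_maximalIdeal_pow_of_le_order)
open Literature.AlgebraicGeometry.Resolution (adicOrder)
open MvPowerSeries (X)
open IsLocalRing (maximalIdeal)

universe u v

/-! ## §1 Case (III): `ord H♭(ϵ(0)) ≥ ord ϵ(0) > q` for every `k̄` -/

section CaseIIIAll

variable {K' : Type v} [Field K'] {n : ℕ} {p : ℕ} [Fact p.Prime] [CharP K' p] {P : ℕ → Ideal (MvPowerSeries (Fin n) K')}

/-- **Case (III), every `k̄`: `ord ϵ(0) ≤ ord (h♭)^{k̄}(ϵ(0))`** for every page-shaped datum — res-type-056's `HFlat.CaseIII.adicOrder_le_caseIII`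
(support classes `𝒜(α,β)`: `∂^{(α+pβ)}` lands on `q`-multiples of order `≥ q`, `∂^{(qγ₀)}` costs at most `q`) fed with the datum's own fields
(`e_pos`, `e ≤ ℓ` from `q_lt_depth`, `Eq76_1_holds`, the Case-(III) witness, `std.ord_lt`). NOT a statement of the manuscript. [folklore] -/
theorem HFlatDatum.adicOrder_le_caseIII_value (d : HFlatDatum p K' n P) (hIII : IsCaseIII p d.q d.α d.β d.γ₀) :
    adicOrder d.ε0 ≤ adicOrder (HFlat.caseIII (hasseFamily K' n) p d.q d.α d.β d.γ₀ d.ε0) := by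
  haveI : CharP (MvPowerSeries (Fin n) K') p :=
    charP_of_injective_ringHom (f := (MvPowerSeries.C : K' →+* MvPowerSeries (Fin n) K')) MvPowerSeries.C_injective p
  have hle : d.e ≤ d.depth := le_of_lt (lt_trans (Nat.lt_pow_self (Fact.out : p.Prime).one_lt) d.q_lt_depth)
  exact HFlat.CaseIII.adicOrder_le_caseIII d.e_pos hle d.S d.γ₀
    (Eq76_1_holds (MvPowerSeries (Fin n) K') n p MvPowerSeries.X d.e d.depth d.ε0 d.S) hIII d.std.ord_lt

/-- **Case (III), every `k̄`: `q < ord H♭(ϵ(0))`** (with §8.3 (1) `q < ord ϵ(0)`). [folklore] -/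
theorem HFlatDatum.q_lt_adicOrder_caseIII_value (d : HFlatDatum p K' n P) (hIII : IsCaseIII p d.q d.α d.β d.γ₀) :
    ((d.q : ℕ) : ℕ∞) < adicOrder (HFlat.caseIII (hasseFamily K' n) p d.q d.α d.β d.γ₀ d.ε0) :=
  lt_of_lt_of_le d.std.ord_lt (d.adicOrder_le_caseIII_value hIII)

/-- **Case (III), every `k̄`: `H♭(ϵ(0)) ∈ 𝔪^{q+1}`.** [folklore] -/
theorem HFlatDatum.caseIII_value_mem_maximalIdeal_pow (d : HFlatDatum p K' n P) (hIII : IsCaseIII p d.q d.α d.β d.γ₀)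
    (hcase : d.case = HFlat.Case.III hIII) : d.value ∈ maximalIdeal (MvPowerSeries (Fin n) K') ^ (d.q + 1) := by
  unfold HFlatDatum.value
  rw [hcase]
  show HFlat.caseIII (hasseFamily K' n) p d.q d.α d.β d.γ₀ d.ε0 ∈ _
  apply mem_maximalIdeal_pow_of_le_order
  have h := d.q_lt_adicOrder_caseIII_value hIII
  rw [adicOrder_eq_order] at h
  exact Order.add_one_le_of_lt (by exact_mod_cast h)

/-- **Case (III) is UNIT-FREE for EVERY `k̄`** (no order clause): `H♭(ϵ(0)) = (h♭)^{k̄}(ϵ(0)) ∈ 𝔪`. Supersedes the `k̄ = 2` theorem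
`HFlatDatum.caseIII_value_mem_maximalIdeal_of_kBar_two` of `…F33StdCaseIII2`. NOT a statement of the manuscript. [folklore] -/
theorem HFlatDatum.caseIII_value_mem_maximalIdeal (d : HFlatDatum p K' n P) (hIII : IsCaseIII p d.q d.α d.β d.γ₀)
    (hcase : d.case = HFlat.Case.III hIII) : d.value ∈ maximalIdeal (MvPowerSeries (Fin n) K') := by
  have h := d.caseIII_value_mem_maximalIdeal_pow hIII hcase
  rw [pow_succ] at h
  exact Ideal.mul_le_left h

end CaseIIIAll

/-! ## §2 Units come only from the (I)∧(II) overlap; «II-first» is unit-free -/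

section Overlap

variable {K' : Type v} [Field K'] {n : ℕ} {p : ℕ} [Fact p.Prime] [CharP K' p] {P : ℕ → Ideal (MvPowerSeries (Fin n) K')}

/-- **R40/#case-overlap, data level: a datum whose witness is NOT «Case (I) inside the (I)∧(II) overlap» has `H♭(ϵ(0)) ∈ 𝔪`.** Case (II):
the factor `x^{α+pβ}`, `α ≠ 0` ((76)(2)); Case (I) with `|α+pβ| ≤ q`: `∂^{(α+pβ)}ϵ(0)` has constant term `coeff_{α+pβ}ϵ(0) = 0` (`q < ord ϵ(0)`);
Case (III): §1. NOT a statement of the manuscript. [folklore] -/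
theorem HFlatDatum.value_mem_maximalIdeal_of_not_overlap (d : HFlatDatum p K' n P)
    (h : ∀ hI : IsCaseI d.q d.γ₀, d.case = HFlat.Case.I hI → ¬ IsCaseII p d.q d.α d.β) :
    d.value ∈ maximalIdeal (MvPowerSeries (Fin n) K') := by
  have hord : ((d.q : ℕ) : ℕ∞) < d.ε0.order := by
    have h' := d.std.ord_lt
    rw [adicOrder_eq_order] at h'
    exact h'
  rcases hc : d.case with hI | hII | hIII
  · have hnot : ¬ IsCaseII p d.q d.α d.β := h hI hc
    unfold HFlatDatum.value
    rw [hc]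
    exact HFlat_caseI_mem_maximalIdeal_of_degree_le d.u₀ p d.q d.α d.β d.γ₀ (not_lt.mp hnot) d.ε0 hord
  · unfold HFlatDatum.value
    rw [hc]
    exact HFlat_caseII_mem_maximalIdeal p d.α d.β d.alpha_ne_zero d.ε0
  · exact d.caseIII_value_mem_maximalIdeal hIII hc

/-- **A UNIT value forces the overlap**: if `H♭(ϵ(0))` is a unit then the witness is Case (I) and Case (II) «|α+pβ| > q» holds as well — the
configuration of `…F33StdCaseI`'s unit datum is the ONLY one. NOT a statement of the manuscript. [folklore] -/
theorem HFlatDatum.caseI_and_isCaseII_of_isUnit_value (d : HFlatDatum p K' n P) (hu : IsUnit d.value) :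
    ∃ hI : IsCaseI d.q d.γ₀, d.case = HFlat.Case.I hI ∧ IsCaseII p d.q d.α d.β := by
  by_contra hne
  push Not at hne
  exact (IsLocalRing.mem_maximalIdeal _).mp (d.value_mem_maximalIdeal_of_not_overlap hne) hu

/-- **Under «II-first» EVERY datum is unit-free** (row 057b `HFlat.selectIIFirst`; no order clause): the selection takes (I) only where (II)
fails. Supersedes `HFlatDatum.value_mem_maximalIdeal_of_selectIIFirst_of_not_caseIII` (`…F33StdSandwich` §4) and
`HFlatDatum.value_mem_maximalIdeal_of_caseIII_kBar_two` (`…F33StdCaseIII2`). NOT a statement of the manuscript. [folklore] -/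
theorem HFlatDatum.value_mem_maximalIdeal_of_selectIIFirst (d : HFlatDatum p K' n P)
    (hsel : d.case = HFlat.selectIIFirst p d.q d.α d.β d.γ₀ d.lem96) :
    d.value ∈ maximalIdeal (MvPowerSeries (Fin n) K') := by
  refine d.value_mem_maximalIdeal_of_not_overlap fun hI hc hII => ?_
  have h2 : d.q < (d.α + p • d.β).degree := hII
  unfold HFlat.selectIIFirst at hsel
  rw [dif_pos h2, hc] at hsel
  cases hsel

/-- Outside Case (II) «|α+pβ| > q» EVERY witness (in particular the «I-first» one) gives a value in `𝔪`: the unit phenomenon needs (II) to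
hold while (I) is evaluated. [folklore] -/
theorem HFlatDatum.value_mem_maximalIdeal_of_not_isCaseII (d : HFlatDatum p K' n P) (hII : ¬ IsCaseII p d.q d.α d.β) :
    d.value ∈ maximalIdeal (MvPowerSeries (Fin n) K') :=
  d.value_mem_maximalIdeal_of_not_overlap fun _ _ => hII

end Overlap

end Summit.ResolutionOfSingularities.ResolutionOfSingularities.Theorems.Campaign.PnegaObligation

/-! ## §3 The «II-first» column DISCRIMINATES: ✓ `jacWitness` -/

namespace Summit.ResolutionOfSingularities.ResolutionOfSingularities.Theorems.Campaign.PnegaInterfaceV4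

open Literature.AlgebraicGeometry.Hironaka2017 Literature.AlgebraicGeometry.Hironaka2017.S09LLUED
open PnegaInterfaceV3 (emptyProvenance)
open IsLocalRing (maximalIdeal)

universe u v

/-- **F3.3 under «II-first» ✓ for the Jacobson witness**: `F33std_RIIfirst K p (jacWitness K hp).tilde` — at a completion placement the value
of every «II-first» datum lies in `𝔪` (`HFlatDatum.value_mem_maximalIdeal_of_selectIIFirst`) and `𝔪 = jac(P 1)` (or the piece is `⊤` when
`P 1 = ⊤`). Every commutative `K`, every prime `p`. NOT a statement of the manuscript. [folklore] -/
theorem jacWitness_F33std_RIIfirst (K : Type u) [CommRing K] {p : ℕ} [Fact p.Prime] (hp : 0 < p) :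
    PnegaObligation.F33std_RIIfirst K p (jacWitness.{u, v} K hp).tilde := by
  intro K' _ _ _ _ n P hP d hsel hneg
  change d.value ∈ jacTildeIdeal P d.degree
  rw [jacTildeIdeal_of_neg P hneg]
  by_cases h1 : P 1 = ⊤
  · rw [h1, Ideal.jacobson_eq_top_iff.mpr rfl]; exact Submodule.mem_top
  · rw [IsLocalRing.jacobson_eq_maximalIdeal (P 1) h1]
    exact d.value_mem_maximalIdeal_of_selectIIFirst hsel

/-- [read-out] **The «II-first» column DISCRIMINATES over V4** exactly like the ORDER column: an `O`-stable (F6c), non-vanishing (F7c)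
inhabitant meets `F33std_RIIfirst` (this file), while the ⊥-bypass, every F6d-elt(e ≥ 1) inhabitant and every F3⁻ inhabitant fail it
(`…F33StdReadings`: `not_F33std_RIIfirst_bypass / _of_normDemand / _of_diffStableNeg`). NOT a statement of the manuscript. [folklore] -/
theorem exists_nonVanishing_and_F33std_RIIfirst (K : Type u) [CommRing K] {p : ℕ} [Fact p.Prime] :
    ∃ I : PnegaInterfaceV4 K p (emptyProvenance.{u, v} K),
      I.OStable ∧ I.NonVanishing ∧ PnegaObligation.F33std_RIIfirst K p I.tilde :=
  ⟨jacWitness K (Fact.out : p.Prime).pos, jacWitness_oStable K _, jacWitness_nonVanishing K _,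
    jacWitness_F33std_RIIfirst K (Fact.out : p.Prime).pos⟩

/-- **The Jacobson witness meets the UNRESTRICTED retyped demand at every datum outside the (I)∧(II) overlap** (the reading as a hypothesis on
the datum; no new obligation is defined): the overlap evaluated by the Case-(I) recipe — `…F33StdCaseI`'s unit datum — is the ONLY reason
`F33std` (any witness, p496649) fails for unit-free candidates (`PnegaInterfaceV4.not_F33std`, p501470). NOT a statement of the manuscript. [folklore] -/
theorem jacWitness_value_mem_of_not_overlap (K : Type u) [CommRing K] {p : ℕ} [Fact p.Prime] (hp : 0 < p)
    {K' : Type v} [Field K'] [Algebra K K'] [CharP K' p] {n : ℕ} (P : ℕ → Ideal (MvPowerSeries (Fin n) K'))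
    (d : PnegaObligation.HFlatDatum p K' n P)
    (h : ∀ hI : IsCaseI d.q d.γ₀, d.case = HFlat.Case.I hI → ¬ IsCaseII p d.q d.α d.β) (hneg : d.degree < 0) :
    d.value ∈ (jacWitness.{u, v} K hp).tilde P d.degree := by
  change d.value ∈ jacTildeIdeal P d.degree
  rw [jacTildeIdeal_of_neg P hneg]
  by_cases h1 : P 1 = ⊤
  · rw [h1, Ideal.jacobson_eq_top_iff.mpr rfl]; exact Submodule.mem_top
  · rw [IsLocalRing.jacobson_eq_maximalIdeal (P 1) h1]
    exact d.value_mem_maximalIdeal_of_not_overlap h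

end Summit.ResolutionOfSingularities.ResolutionOfSingularities.Theorems.Campaign.PnegaInterfaceV4
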